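import Literature.NumberTheory.GaloisRepresentations.AbsDecompositionDegreeTransfer
import Literature.AnabelianGeometry.AbsoluteAnabelian.NeukirchUchidaCorrespondenceTransport
import Literature.AnabelianGeometry.AbsoluteAnabelian.NeukirchUchidaLocalInvariantsOmega
import Literature.AnabelianGeometry.AbsoluteAnabelian.NeukirchUchidaGaloisInvariance
import Literature.AnabelianGeometry.AbsoluteAnabelian.NeukirchUchidaRatCore
import Mathlib.NumberTheory.Padics.HeightOneSpectrum
import HarnessLib

/-!
# The Neukirch–Uchida deduction, row R4 (c): degrees and degree-one primes along the prime
# correspondence of `β : U₁ ⥲ U₂` — the `hdeg` / `hP₁` binders of the `ℚ`-core, DISCHARGED from (12.1.9)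

J. Neukirch, A. Schmidt, K. Wingberg, *Cohomology of Number Fields* (2nd ed.), Ch. XII §2, proof of
Thm. (12.2.1) (Neukirch–Uchida), «arithmetic equivalence of the fixed fields»: for a topological
isomorphism `β : U₁ ⥲ U₂` of open subgroups of `Γ = G_ℚ` satisfying the containment lemma (12.1.9) (for `β`
and `β⁻¹`), and an open `V ≤ U₁` with image `W = β(V) ≤ U₂`, the fixed fields `K_V`, `K_W ⊆ ℚ̄` have the
SAME DEGREE over `ℚ`, and a rational prime with a degree-one divisor in `K_W` has one in `K_V`.

PROOF-ONLY (no `def`).  abc-iut cell, GAP-LEDGER row G-L4d2g4-1, sub-DAG `plan/L4/SUBDAG-NeukirchUchida.md`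
row R4 (holder abc-iut-L4-d2), sub-brick «R4c» (seat abc-iut-w6-d108): the INSTANTIATION of the counting
brick «R4a» (`AbsDecompositionDegreeTransfer`, binders (R0)–(R3) over an abstract correspondence) at
`Rel A B := A ≠ ⊤ ∧ B ≠ ⊤ ∧ Corr β A B`, `Corr β A B := ((D A).subgroupOf U₁).map β = (D B).subgroupOf U₂`:
(R0)/(R0′) from row R1 (`existsUnique_map_stabilizer_subgroupOf_eq_of_isOpen`, abc-iut-L4-d2); (R1) from
row R4 (b) (`exists_smul_eq_iff_of_map_stabilizer_eq`, abc-iut-L4-d2); (R2), (R3) from row R2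
(`invariants_of_stabilizer_inf_ΓK_equiv`, abc-iut-w5-d116) along row R4 (b)'s restriction
`D_A ∩ V ≃ₜ* D_B ∩ W` (`exists_continuousMulEquiv_stabilizer_inf`), with «over the same rational prime ⇒
over the same place of `ℚ`» (`Rat.HeightOneSpectrum.primesEquiv`).  OUTPUT = literally the binders `hdeg`,
`hP₁` of `existsUnique_forall_eq_conj_of_rows` / the first two conjuncts of `hrows` in
`neukirchUchida_of_rows` (`NeukirchUchidaRatCore`, abc-iut-L4-d2), at every open `V ≤ U₁`.

* `isOpen_map_map_subtype_of_continuousMulEquiv` — `W = β(V)` read in `Γ` is open;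
* `under_eq_under_of_forall_natCast_mem_iff` — two primes of number fields containing the same rational
  primes lie over the same prime of `𝓞 ℚ`; `over_iff_under_eq` — «`A` over `v₀`» ⟺ `P ∩ 𝓞 ℚ = v₀`;
* **`hdeg_hP₁_of_containment`** — row R4 OUT (i), (ii) from the (12.1.9)-containments for `β`, `β⁻¹`;
* **`existsUnique_forall_eq_conj_of_containment_of_sep`** — abc-iut-L4-d2's `ℚ`-core
  (`existsUnique_forall_eq_conj_of_rows`) with `hdeg`/`hP₁` DISCHARGED: only (12.1.9) and the separation
  oracle `hsep` remain as hypotheses.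

HONEST FRAMING: classical algebraic number theory, outside the [IUTchIII] Cor. 3.12 cone; (12.1.9) enters
as the two displayed containment hypotheses; nothing here takes a side.

## References
* [NeukirchSchmidtWingberg2008] Neukirch–Schmidt–Wingberg, *Cohomology of Number Fields*, Thm (12.2.1) and its proof.
* [NeukirchANT1999] J. Neukirch, *Algebraic Number Theory*, Ch. I (8.2), Ch. I §9, Ch. VII (13.9).
-/

noncomputable section

open scoped Pointwise NumberField
open Field IsDedekindDomain

namespace Literature.AnabelianGeometry.AbsoluteAnabelian

namespace NeukirchUchidaProof

open Literature.NumberTheory.GaloisRepresentations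
open Literature.NumberTheory.GaloisRepresentations.NeukirchUchidaProof

variable {U₁ U₂ : Subgroup (absoluteGaloisGroup ℚ)}

/-! ### Topological bookkeeping: the image `W = β(V)` is open -/

/-- For `β : U₁ ≃ₜ* U₂` with `U₂` open in `Γ` and `V ≤ Γ` open, the image `β(V ∩ U₁)` read in `Γ` is open.
[cite: NeukirchSchmidtWingberg2008, Thm (12.2.1)] -/
theorem isOpen_map_map_subtype_of_continuousMulEquiv (hU₂ : IsOpen (U₂ : Set (absoluteGaloisGroup ℚ)))
    (β : U₁ ≃ₜ* U₂) (V : Subgroup (absoluteGaloisGroup ℚ)) (hV : IsOpen (V : Set (absoluteGaloisGroup ℚ))) :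
    IsOpen ((((V.subgroupOf U₁).map β.toMulEquiv.toMonoidHom).map U₂.subtype :
      Subgroup (absoluteGaloisGroup ℚ)) : Set (absoluteGaloisGroup ℚ)) := by
  have h1 : IsOpen ((V.subgroupOf U₁ : Subgroup U₁) : Set U₁) := by
    rw [Subgroup.subgroupOf, Subgroup.coe_comap]
    exact hV.preimage continuous_subtype_val
  have h2 : IsOpen (((V.subgroupOf U₁).map β.toMulEquiv.toMonoidHom : Subgroup U₂) : Set U₂) := by
    rw [Subgroup.coe_map]
    exact β.toHomeomorph.isOpenMap _ h1
  rw [Subgroup.coe_map]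
  exact hU₂.isOpenMap_subtype_val _ h2

/-- An open subgroup of `Γ = G_ℚ` has finite index. [folklore] -/
private theorem finiteIndex_of_isOpen' (U : Subgroup (absoluteGaloisGroup ℚ))
    (hU : IsOpen (U : Set (absoluteGaloisGroup ℚ))) : U.FiniteIndex := by
  haveI : Finite (absoluteGaloisGroup ℚ ⧸ U) := Subgroup.quotient_finite_of_isOpen U hU
  exact Subgroup.finiteIndex_of_finite_quotient

/-! ### Places of `ℚ` under primes of number fields inside `ℚ̄` -/

/-- Over `ℚ` a rational prime lies under exactly ONE finite place (`Rat.HeightOneSpectrum.primesEquiv`).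
[cite: NeukirchANT1999, Ch. I (8.2)] -/
private theorem heightOneSpectrum_rat_eq_of_natCast_mem' {q : ℕ} (hq : q.Prime)
    {v w : HeightOneSpectrum (𝓞 ℚ)} (hv : ((q : ℕ) : 𝓞 ℚ) ∈ v.asIdeal)
    (hw : ((q : ℕ) : 𝓞 ℚ) ∈ w.asIdeal) : v = w := by
  have key : ∀ u : HeightOneSpectrum (𝓞 ℚ), ((q : ℕ) : 𝓞 ℚ) ∈ u.asIdeal →
      Rat.HeightOneSpectrum.natGenerator u = q := fun u hu => by
    have hdvd : Rat.HeightOneSpectrum.natGenerator u ∣ q := by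
      rw [Rat.HeightOneSpectrum.natGenerator_dvd_iff]
      simpa only [map_natCast] using
        Ideal.mem_map_of_mem (Rat.IsIntegralClosure.intEquiv (𝓞 ℚ)) hu
    exact (Nat.prime_dvd_prime_iff_eq (Rat.HeightOneSpectrum.prime_natGenerator u) hq).1 hdvd
  refine (Rat.HeightOneSpectrum.primesEquiv (R := 𝓞 ℚ)).injective (Subtype.ext ?_)
  change Rat.HeightOneSpectrum.natGenerator v = Rat.HeightOneSpectrum.natGenerator w
  rw [key v hv, key w hw]

/-- Every nonzero prime of a number field contains a rational prime (its residue characteristic).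
[cite: NeukirchANT1999, Ch. I (8.2)] -/
private theorem exists_natPrime_natCast_mem' {K : Type*} [Field K] [NumberField K] (P : Ideal (𝓞 K))
    [P.IsMaximal] (hP : P ≠ ⊥) : ∃ p : ℕ, p.Prime ∧ ((p : ℕ) : 𝓞 K) ∈ P := by
  letI : Field (𝓞 K ⧸ P) := Ideal.Quotient.field P
  haveI : Finite (𝓞 K ⧸ P) := Ideal.finiteQuotientOfFreeOfNeBot P hP
  letI : Fintype (𝓞 K ⧸ P) := Fintype.ofFinite _
  obtain ⟨_, hp, _⟩ := FiniteField.card (𝓞 K ⧸ P) (ringChar (𝓞 K ⧸ P))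
  refine ⟨ringChar (𝓞 K ⧸ P), hp, ?_⟩
  rw [← Ideal.Quotient.eq_zero_iff_mem, map_natCast]
  exact ringChar.Nat.cast_ringChar

/-- **Same rational primes ⇒ same place of `ℚ` below**: two maximal ideals `P ⊆ 𝓞 K`, `P' ⊆ 𝓞 K'` of number
fields which contain the same rational primes lie over the same prime of `𝓞 ℚ`.
[cite: NeukirchANT1999, Ch. I (8.2)] -/
theorem under_eq_under_of_forall_natCast_mem_iff {K K' : Type*} [Field K] [NumberField K] [Field K']
    [NumberField K'] {P : Ideal (𝓞 K)} {P' : Ideal (𝓞 K')} [P.IsMaximal] [P'.IsMaximal] (hP : P ≠ ⊥)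
    (h : ∀ p : ℕ, p.Prime → (((p : ℕ) : 𝓞 K) ∈ P ↔ ((p : ℕ) : 𝓞 K') ∈ P')) :
    P.under (𝓞 ℚ) = P'.under (𝓞 ℚ) := by
  obtain ⟨p, hp, hpP⟩ := exists_natPrime_natCast_mem' P hP
  have hpP' : ((p : ℕ) : 𝓞 K') ∈ P' := (h p hp).mp hpP
  have hp0 : ((p : ℕ) : 𝓞 ℚ) ≠ 0 := Nat.cast_ne_zero.mpr hp.ne_zero
  have hmem : ((p : ℕ) : 𝓞 ℚ) ∈ P.under (𝓞 ℚ) := by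
    rw [Ideal.under_def, Ideal.mem_comap, map_natCast]; exact hpP
  have hmem' : ((p : ℕ) : 𝓞 ℚ) ∈ P'.under (𝓞 ℚ) := by
    rw [Ideal.under_def, Ideal.mem_comap, map_natCast]; exact hpP'
  have hne : P.under (𝓞 ℚ) ≠ ⊥ := fun h0 => hp0 (by rw [h0, Ideal.mem_bot] at hmem; exact hmem)
  have hne' : P'.under (𝓞 ℚ) ≠ ⊥ := fun h0 => hp0 (by rw [h0, Ideal.mem_bot] at hmem'; exact hmem')
  let u : HeightOneSpectrum (𝓞 ℚ) := ⟨P.under (𝓞 ℚ), Ideal.comap_isPrime _ P, hne⟩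
  let u' : HeightOneSpectrum (𝓞 ℚ) := ⟨P'.under (𝓞 ℚ), Ideal.comap_isPrime _ P', hne'⟩
  have huu' : u = u' := heightOneSpectrum_rat_eq_of_natCast_mem' hp (v := u) (w := u') hmem hmem'
  exact congrArg HeightOneSpectrum.asIdeal huu'

/-- «`A` over `v₀`» (the base-`ℚ` spelling of R4a) in terms of the prime `P` of `𝓞 K` below `A`:
`P ∩ 𝓞 ℚ = v₀`. [cite: NeukirchANT1999, Ch. I §9] -/
theorem over_iff_under_eq (K : IntermediateField ℚ (AlgebraicClosure ℚ))
    {A : ValuationSubring (AlgebraicClosure ℚ)} {P : Ideal (𝓞 K)}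
    (hPA : ∀ x : 𝓞 K, ((x : K) : AlgebraicClosure ℚ) ∈ A.nonunits ↔ x ∈ P) (v₀ : HeightOneSpectrum (𝓞 ℚ)) :
    (∀ r : 𝓞 ℚ, algebraMap ℚ (AlgebraicClosure ℚ) r ∈ A.nonunits ↔ r ∈ v₀.asIdeal) ↔
      P.under (𝓞 ℚ) = v₀.asIdeal := by
  constructor
  · intro h
    ext r
    exact (mem_under_of_below K A hPA r).trans (h r)
  · intro h r
    have h1 : r ∈ P.under (𝓞 ℚ) ↔ r ∈ v₀.asIdeal := by rw [h]
    exact (mem_under_of_below K A hPA r).symm.trans h1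

/-! ### R4 (c): the counting brick instantiated at `Corr β` -/

section Main

/-- **The binders (R0)–(R3) of R4a at `Rel := Corr β` and the degree / degree-one transfer** (row R4 OUT (i),
(ii) of the sub-DAG; = the `hdeg`, `hP₁` binders of `existsUnique_forall_eq_conj_of_rows`).  `Γ = G_ℚ`,
`U₁ U₂ ≤ Γ` open, `β : U₁ ≃ₜ* U₂` with the (12.1.9)-containments `hβ` (for `β`) and `hβ'` (for `β⁻¹`),
`V ≤ U₁` open, `W := β(V ∩ U₁)` read in `Γ`.  Then `finrank ℚ K_V = finrank ℚ K_W`, and for every place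
`v₀` of `ℚ` a prime of `𝓞 K_W` over `v₀` with `e = f = 1` yields one of `𝓞 K_V`.
[cite: NeukirchSchmidtWingberg2008, Thm (12.2.1)] [cite: NeukirchANT1999, Ch. VII Prop. (13.9)] -/
theorem hdeg_hP₁_of_containment (hU₁ : IsOpen (U₁ : Set (absoluteGaloisGroup ℚ)))
    (hU₂ : IsOpen (U₂ : Set (absoluteGaloisGroup ℚ))) (β : U₁ ≃ₜ* U₂)
    (hβ : ∀ A : ValuationSubring (AlgebraicClosure ℚ), A ≠ ⊤ →
      ∃ B : ValuationSubring (AlgebraicClosure ℚ), B ≠ ⊤ ∧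
        ((MulAction.stabilizer (absoluteGaloisGroup ℚ) A).subgroupOf U₁).map β.toMulEquiv.toMonoidHom ≤
          (MulAction.stabilizer (absoluteGaloisGroup ℚ) B).subgroupOf U₂)
    (hβ' : ∀ B : ValuationSubring (AlgebraicClosure ℚ), B ≠ ⊤ →
      ∃ A : ValuationSubring (AlgebraicClosure ℚ), A ≠ ⊤ ∧
        ((MulAction.stabilizer (absoluteGaloisGroup ℚ) B).subgroupOf U₂).map
            β.toMulEquiv.symm.toMonoidHom ≤
          (MulAction.stabilizer (absoluteGaloisGroup ℚ) A).subgroupOf U₁)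
    (V : Subgroup (absoluteGaloisGroup ℚ)) (hV : IsOpen (V : Set (absoluteGaloisGroup ℚ))) (hVU : V ≤ U₁) :
    Module.finrank ℚ (KV V) =
        Module.finrank ℚ (KV (((V.subgroupOf U₁).map β.toMulEquiv.toMonoidHom).map U₂.subtype)) ∧
      ∀ v₀ : HeightOneSpectrum (𝓞 ℚ),
        (∃ P' ∈ v₀.asIdeal.primesOver
            (𝓞 (KV (((V.subgroupOf U₁).map β.toMulEquiv.toMonoidHom).map U₂.subtype))),
            P'.ramificationIdx (𝓞 ℚ) = 1 ∧ P'.inertiaDeg (𝓞 ℚ) = 1) →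
          ∃ P ∈ v₀.asIdeal.primesOver (𝓞 (KV V)), P.ramificationIdx (𝓞 ℚ) = 1 ∧ P.inertiaDeg (𝓞 ℚ) = 1 := by
  classical
  set W : Subgroup (absoluteGaloisGroup ℚ) :=
    ((V.subgroupOf U₁).map β.toMulEquiv.toMonoidHom).map U₂.subtype with hWdef
  have hW : IsOpen (W : Set (absoluteGaloisGroup ℚ)) :=
    isOpen_map_map_subtype_of_continuousMulEquiv hU₂ β V hV
  haveI : U₁.FiniteIndex := finiteIndex_of_isOpen' U₁ hU₁
  haveI : U₂.FiniteIndex := finiteIndex_of_isOpen' U₂ hU₂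
  haveI : FiniteDimensional ℚ (KV V) := finiteDimensional_KV V hV
  haveI : FiniteDimensional ℚ (KV W) := finiteDimensional_KV W hW
  haveI : NumberField (KV V) := numberField_intermediateField (KV V)
  haveI : NumberField (KV W) := numberField_intermediateField (KV W)
  have hΓV : ΓK (KV V) = V := ΓK_KV V hV
  have hΓW : ΓK (KV W) = W := ΓK_KV W hW
  -- the relation
  set Rel : ValuationSubring (AlgebraicClosure ℚ) → ValuationSubring (AlgebraicClosure ℚ) → Prop :=
    fun A B => A ≠ ⊤ ∧ B ≠ ⊤ ∧
      ((MulAction.stabilizer (absoluteGaloisGroup ℚ) A).subgroupOf U₁).map β.toMulEquiv.toMonoidHom =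
        (MulAction.stabilizer (absoluteGaloisGroup ℚ) B).subgroupOf U₂ with hRel
  -- (R0), (R0′): existence of partners (row R1, for `β` and for `β⁻¹`)
  have hR0 : ∀ (v : HeightOneSpectrum (𝓞 ℚ)) (A : ValuationSubring (AlgebraicClosure ℚ)), A ≠ ⊤ →
      (∀ r : 𝓞 ℚ, algebraMap ℚ (AlgebraicClosure ℚ) r ∈ A.nonunits ↔ r ∈ v.asIdeal) →
        ∃ B : ValuationSubring (AlgebraicClosure ℚ), B ≠ ⊤ ∧ Rel A B := by
    intro v A hA _
    obtain ⟨B, ⟨hB, hAB⟩, -⟩ := existsUnique_map_stabilizer_subgroupOf_eq_of_isOpen hU₁ hU₂ β hβ hβ' A hA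
    exact ⟨B, hB, hA, hB, hAB⟩
  have hR0' : ∀ (v : HeightOneSpectrum (𝓞 ℚ)) (B : ValuationSubring (AlgebraicClosure ℚ)), B ≠ ⊤ →
      (∀ r : 𝓞 ℚ, algebraMap ℚ (AlgebraicClosure ℚ) r ∈ B.nonunits ↔ r ∈ v.asIdeal) →
        ∃ A : ValuationSubring (AlgebraicClosure ℚ), A ≠ ⊤ ∧ Rel A B := by
    intro v B hB _
    obtain ⟨A, ⟨hA, hBA⟩, -⟩ :=
      existsUnique_map_stabilizer_subgroupOf_eq_of_isOpen hU₂ hU₁ β.symm hβ' hβ B hB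
    refine ⟨A, hA, hA, hB, ?_⟩
    exact map_symm_eq_of_map_eq β.symm.toMulEquiv hBA
  -- (R1): orbits (row R4 (b))
  have hR1 : ∀ A B A₂ B₂, Rel A B → Rel A₂ B₂ →
      ((∃ u ∈ ΓK (KV V), u • A = A₂) ↔ (∃ w ∈ ΓK (KV W), w • B = B₂)) := by
    rintro A B A₂ B₂ ⟨hA, hB, h⟩ ⟨hA₂, hB₂, h₂⟩
    rw [hΓV, hΓW]
    exact exists_smul_eq_iff_of_map_stabilizer_eq β.toMulEquiv hVU hA hB hA₂ hB₂ h h₂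
  -- the topological isomorphism `D_A ∩ Γ_{K_V} ≃ₜ* D_B ∩ Γ_{K_W}` of a related pair (row R4 (b))
  have hequiv : ∀ A B, Rel A B →
      Nonempty (↥(MulAction.stabilizer (absoluteGaloisGroup ℚ) A ⊓ ΓK (KV V)) ≃ₜ*
        ↥(MulAction.stabilizer (absoluteGaloisGroup ℚ) B ⊓ ΓK (KV W))) := by
    rintro A B ⟨-, -, h⟩
    rw [hΓV, hΓW]
    obtain ⟨e, -⟩ := exists_continuousMulEquiv_stabilizer_inf β hVU h
    exact ⟨e⟩
  -- the places below a related pair, and row R2's invariants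
  have hinv : ∀ A B (P : Ideal (𝓞 (KV V))) (P' : Ideal (𝓞 (KV W))), Rel A B →
      (∀ x : 𝓞 (KV V), ((x : KV V) : AlgebraicClosure ℚ) ∈ A.nonunits ↔ x ∈ P) →
      (∀ x : 𝓞 (KV W), ((x : KV W) : AlgebraicClosure ℚ) ∈ B.nonunits ↔ x ∈ P') →
        (∀ p : ℕ, p.Prime → (((p : ℕ) : 𝓞 (KV V)) ∈ P ↔ ((p : ℕ) : 𝓞 (KV W)) ∈ P')) ∧
          P.inertiaDeg (𝓞 ℚ) = P'.inertiaDeg (𝓞 ℚ) ∧ P.ramificationIdx (𝓞 ℚ) = P'.ramificationIdx (𝓞 ℚ) := by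
    intro A B P P' hAB hPA hP'B
    have hA : A ≠ ⊤ := hAB.1
    have hB : B ≠ ⊤ := hAB.2.1
    haveI hPmax : P.IsMaximal := isMaximal_of_below (KV V) A hA hPA
    haveI hP'max : P'.IsMaximal := isMaximal_of_below (KV W) B hB hP'B
    let vK : HeightOneSpectrum (𝓞 (KV V)) := ⟨P, hPmax.isPrime, ne_bot_of_below (KV V) A hA hPA⟩
    let vK' : HeightOneSpectrum (𝓞 (KV W)) := ⟨P', hP'max.isPrime, ne_bot_of_below (KV W) B hB hP'B⟩
    obtain ⟨e⟩ := hequiv A B hAB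
    obtain ⟨hchar, -, -, -, -, hf, he⟩ :=
      invariants_of_stabilizer_inf_ΓK_equiv (KV V) (KV W) A hA vK hPA B hB vK' hP'B e
    exact ⟨hchar, hf, he⟩
  -- (R2): «over v₀» is preserved
  have hR2 : ∀ (v : HeightOneSpectrum (𝓞 ℚ)) A B, Rel A B →
      ((∀ r : 𝓞 ℚ, algebraMap ℚ (AlgebraicClosure ℚ) r ∈ A.nonunits ↔ r ∈ v.asIdeal) ↔
        (∀ r : 𝓞 ℚ, algebraMap ℚ (AlgebraicClosure ℚ) r ∈ B.nonunits ↔ r ∈ v.asIdeal)) := by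
    intro v A B hAB
    obtain ⟨P, hPA, -⟩ := existsUnique_ideal_below (KV V) A
    obtain ⟨P', hP'B, -⟩ := existsUnique_ideal_below (KV W) B
    obtain ⟨hchar, -, -⟩ := hinv A B P P' hAB hPA hP'B
    haveI : P.IsMaximal := isMaximal_of_below (KV V) A hAB.1 hPA
    haveI : P'.IsMaximal := isMaximal_of_below (KV W) B hAB.2.1 hP'B
    have hunder := under_eq_under_of_forall_natCast_mem_iff (ne_bot_of_below (KV V) A hAB.1 hPA) hchar
    rw [over_iff_under_eq (KV V) hPA v, over_iff_under_eq (KV W) hP'B v]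
    exact ⟨fun h1 => hunder.symm.trans h1, fun h2 => hunder.trans h2⟩
  -- (R3): `e·f` is preserved
  have hR3 : ∀ A B (P : Ideal (𝓞 (KV V))) (P' : Ideal (𝓞 (KV W))), Rel A B → A ≠ ⊤ →
      (∀ x : 𝓞 (KV V), ((x : KV V) : AlgebraicClosure ℚ) ∈ A.nonunits ↔ x ∈ P) →
      (∀ x : 𝓞 (KV W), ((x : KV W) : AlgebraicClosure ℚ) ∈ B.nonunits ↔ x ∈ P') →
        P.ramificationIdx (𝓞 ℚ) * P.inertiaDeg (𝓞 ℚ) = P'.ramificationIdx (𝓞 ℚ) * P'.inertiaDeg (𝓞 ℚ) := by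
    intro A B P P' hAB _ hPA hP'B
    obtain ⟨-, hf, he⟩ := hinv A B P P' hAB hPA hP'B
    rw [hf, he]
  -- a place of `ℚ` (to run the counting at)
  obtain ⟨p₀, hp₀0, hp₀⟩ :=
    Ring.not_isField_iff_exists_prime.mp (NumberField.RingOfIntegers.not_isField (K := ℚ))
  let v₁ : HeightOneSpectrum (𝓞 ℚ) := ⟨p₀, hp₀, hp₀0⟩
  refine ⟨finrank_eq_of_rel_rat (KV V) (KV W) Rel v₁ (hR0 v₁) (hR0' v₁) hR1 (hR2 v₁) hR3, fun v₀ h => ?_⟩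
  exact exists_degOne_of_exists_degOne_of_rel_rat (KV V) (KV W) Rel v₀ (hR0' v₀) (hR2 v₀) hR3 h

/-- **The `ℚ`-core with the row-R4 data DISCHARGED**: abc-iut-L4-d2's `existsUnique_forall_eq_conj_of_rows`
(`NeukirchUchidaRatCore`) with its `hdeg`/`hP₁` binders supplied by `hdeg_hP₁_of_containment` — for
`β : U₁ ⥲ U₂` (open subgroups of `Γ = G_ℚ`) satisfying the (12.1.9)-containments, a finite Galois `N` with
`Γ_N ≤ U₁` and the separation oracle `hsep` (row R9 / «R10b») there is a UNIQUE `τ ∈ Γ` with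
`β(u) = τ u τ⁻¹` on `U₁`.  What remains named: (12.1.9) (as `hβ`, `hβ'`) and `hsep`.
[cite: NeukirchSchmidtWingberg2008, Thm (12.2.1)] -/
theorem existsUnique_forall_eq_conj_of_containment_of_sep (hU₁ : IsOpen (U₁ : Set (absoluteGaloisGroup ℚ)))
    (hU₂ : IsOpen (U₂ : Set (absoluteGaloisGroup ℚ))) (β : U₁ ≃ₜ* U₂)
    (hβ : ∀ A : ValuationSubring (AlgebraicClosure ℚ), A ≠ ⊤ →
      ∃ B : ValuationSubring (AlgebraicClosure ℚ), B ≠ ⊤ ∧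
        ((MulAction.stabilizer (absoluteGaloisGroup ℚ) A).subgroupOf U₁).map β.toMulEquiv.toMonoidHom ≤
          (MulAction.stabilizer (absoluteGaloisGroup ℚ) B).subgroupOf U₂)
    (hβ' : ∀ B : ValuationSubring (AlgebraicClosure ℚ), B ≠ ⊤ →
      ∃ A : ValuationSubring (AlgebraicClosure ℚ), A ≠ ⊤ ∧
        ((MulAction.stabilizer (absoluteGaloisGroup ℚ) B).subgroupOf U₂).map
            β.toMulEquiv.symm.toMonoidHom ≤
          (MulAction.stabilizer (absoluteGaloisGroup ℚ) A).subgroupOf U₁)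
    (N : IntermediateField ℚ (AlgebraicClosure ℚ)) [FiniteDimensional ℚ N] [IsGalois ℚ N]
    (hNU : ΓK N ≤ U₁)
    (hsep : ∀ M : IntermediateField ℚ (AlgebraicClosure ℚ), FiniteDimensional ℚ M → IsGalois ℚ M →
      N ≤ M → ∃ (A₀ : ValuationSubring (AlgebraicClosure ℚ)) (m₀ m₁ : absoluteGaloisGroup ℚ),
        ((MulAction.stabilizer (absoluteGaloisGroup ℚ) A₀).subgroupOf U₁).map β.toMulEquiv.toMonoidHom =
          (MulAction.stabilizer (absoluteGaloisGroup ℚ) (m₀ • A₀)).subgroupOf U₂ ∧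
        ∀ (a : absoluteGaloisGroup ℚ) (_ : a ∈ ΓK N) (m : absoluteGaloisGroup ℚ),
          (∀ (g : absoluteGaloisGroup ℚ) (hg : g ∈ ΓK N),
            g ∈ MulAction.stabilizer (absoluteGaloisGroup ℚ) (a • A₀) ↔
              ((β ⟨g, hNU hg⟩ : U₂) : absoluteGaloisGroup ℚ) ∈
                MulAction.stabilizer (absoluteGaloisGroup ℚ) (m • a • A₀)) →
          m⁻¹ * m₁ ∈ ΓK M) :
    ∃! τ : absoluteGaloisGroup ℚ, ∀ u : U₁, ((β u : U₂) : absoluteGaloisGroup ℚ) = τ * u * τ⁻¹ := by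
  obtain ⟨hdeg, hP₁⟩ := hdeg_hP₁_of_containment hU₁ hU₂ β hβ hβ' (ΓK N) (isOpen_ΓK N) hNU
  exact existsUnique_forall_eq_conj_of_rows hU₁ β N hNU hdeg hP₁ hsep

end Main

/-! ### Corollaries of (12.1.9): Γ-invariance of every Galois level (row R10b needs it at the
Kummer field: row R6 fed by `hdeg_hP₁_of_containment` at `V = Γ_{M'}`), equal indices -/

section Corollaries

/-- **Γ-INVARIANCE OF GALOIS LEVELS FROM (12.1.9)** ([NSW] Thm. (12.2.1), proof, step
«`α(G_M) = G_M` for every finite Galois `M/ℚ` with `G_M ⊆ U₁`»): for open `U₁, U₂ ≤ Γ`,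
`β : U₁ ≃ₜ* U₂` satisfying the (12.1.9) containments for `β` and `β⁻¹`, and a finite Galois `M/ℚ`
inside `Ω` with `Γ_M ≤ U₁`: `β(Γ_M ∩ U₁) = Γ_M ∩ U₂` and `Γ_M ≤ U₂`.  Row R4 (this file's
`hdeg_hP₁_of_containment` at `V = Γ_M`, arithmetic equivalence) feeds row R6
(`map_ΓK_subgroupOf_eq_of_KV_of_continuousMulEquiv`, abc-iut-w6-d108: Bauer's theorem).
[cite: NeukirchSchmidtWingberg2008, Thm (12.2.1)] -/
theorem map_ΓK_subgroupOf_eq_of_containment (hU₁ : IsOpen (U₁ : Set (absoluteGaloisGroup ℚ)))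
    (hU₂ : IsOpen (U₂ : Set (absoluteGaloisGroup ℚ))) (β : U₁ ≃ₜ* U₂)
    (hβ : ∀ A : ValuationSubring (AlgebraicClosure ℚ), A ≠ ⊤ →
      ∃ B : ValuationSubring (AlgebraicClosure ℚ), B ≠ ⊤ ∧
        ((MulAction.stabilizer (absoluteGaloisGroup ℚ) A).subgroupOf U₁).map β.toMulEquiv.toMonoidHom ≤
          (MulAction.stabilizer (absoluteGaloisGroup ℚ) B).subgroupOf U₂)
    (hβ' : ∀ B : ValuationSubring (AlgebraicClosure ℚ), B ≠ ⊤ →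
      ∃ A : ValuationSubring (AlgebraicClosure ℚ), A ≠ ⊤ ∧
        ((MulAction.stabilizer (absoluteGaloisGroup ℚ) B).subgroupOf U₂).map
            β.toMulEquiv.symm.toMonoidHom ≤
          (MulAction.stabilizer (absoluteGaloisGroup ℚ) A).subgroupOf U₁)
    (M : IntermediateField ℚ (AlgebraicClosure ℚ)) [FiniteDimensional ℚ M] [IsGalois ℚ M]
    (hMU : ΓK M ≤ U₁) :
    ((ΓK M).subgroupOf U₁).map β.toMulEquiv.toMonoidHom = (ΓK M).subgroupOf U₂ ∧ ΓK M ≤ U₂ := by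
  obtain ⟨hdeg, hP₁⟩ := hdeg_hP₁_of_containment hU₁ hU₂ β hβ hβ' (ΓK M) (isOpen_ΓK M) hMU
  exact map_ΓK_subgroupOf_eq_of_KV_of_continuousMulEquiv β M hMU _ rfl hdeg hP₁

/-- The same for `β⁻¹`: `β⁻¹(Γ_M ∩ U₂) = Γ_M ∩ U₁` (from `β(Γ_M ∩ U₁) = Γ_M ∩ U₂` by applying `β⁻¹`).
[cite: NeukirchSchmidtWingberg2008, Thm (12.2.1)] -/
theorem map_symm_ΓK_subgroupOf_eq_of_containment (hU₁ : IsOpen (U₁ : Set (absoluteGaloisGroup ℚ)))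
    (hU₂ : IsOpen (U₂ : Set (absoluteGaloisGroup ℚ))) (β : U₁ ≃ₜ* U₂)
    (hβ : ∀ A : ValuationSubring (AlgebraicClosure ℚ), A ≠ ⊤ →
      ∃ B : ValuationSubring (AlgebraicClosure ℚ), B ≠ ⊤ ∧
        ((MulAction.stabilizer (absoluteGaloisGroup ℚ) A).subgroupOf U₁).map β.toMulEquiv.toMonoidHom ≤
          (MulAction.stabilizer (absoluteGaloisGroup ℚ) B).subgroupOf U₂)
    (hβ' : ∀ B : ValuationSubring (AlgebraicClosure ℚ), B ≠ ⊤ →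
      ∃ A : ValuationSubring (AlgebraicClosure ℚ), A ≠ ⊤ ∧
        ((MulAction.stabilizer (absoluteGaloisGroup ℚ) B).subgroupOf U₂).map
            β.toMulEquiv.symm.toMonoidHom ≤
          (MulAction.stabilizer (absoluteGaloisGroup ℚ) A).subgroupOf U₁)
    (M : IntermediateField ℚ (AlgebraicClosure ℚ)) [FiniteDimensional ℚ M] [IsGalois ℚ M]
    (hMU : ΓK M ≤ U₁) :
    ((ΓK M).subgroupOf U₂).map β.toMulEquiv.symm.toMonoidHom = (ΓK M).subgroupOf U₁ := by
  rw [← (map_ΓK_subgroupOf_eq_of_containment hU₁ hU₂ β hβ hβ' M hMU).1, Subgroup.map_map]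
  have : β.toMulEquiv.symm.toMonoidHom.comp β.toMulEquiv.toMonoidHom = MonoidHom.id U₁ := by
    ext u
    simp
  rw [this, Subgroup.map_id]

/-- For an OPEN subgroup `U ≤ Γ`: `[K_U : ℚ] = [Γ : U]` (Galois correspondence: `Γ_{K_U} = U`).
[cite: NeukirchANT1999, Ch. IV §1] -/
theorem finrank_KV_eq_index (U : Subgroup (absoluteGaloisGroup ℚ))
    (hU : IsOpen (U : Set (absoluteGaloisGroup ℚ))) : Module.finrank ℚ (KV U) = U.index := by
  -- the two `Module ℚ ↥(KV U)` instances (intermediate field / `ℚ`-division ring) agree definitionally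
  have h := finrank_eq_index_fixingSubgroup_comap (F := ℚ) (KV U)
  have h2 : (KV U).fixingSubgroup.comap (absoluteGaloisGroup.toAlgEquiv ℚ).toMonoidHom = U :=
    (ΓK_eq_comap (KV U)).symm.trans (ΓK_KV U hU)
  exact h.trans (congrArg Subgroup.index h2)

/-- The image of `U₁` itself under `β : U₁ ≃ₜ* U₂`, pushed into `Γ`, is `U₂`. [folklore] -/
private theorem map_map_subtype_self (β : U₁ ≃ₜ* U₂) :
    ((U₁.subgroupOf U₁).map β.toMulEquiv.toMonoidHom).map U₂.subtype = U₂ := by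
  rw [Subgroup.subgroupOf_self, Subgroup.map_top_of_surjective _ β.surjective,
    ← MonoidHom.range_eq_map, Subgroup.range_subtype]

/-- **EQUAL INDICES FROM (12.1.9)** (row R4 OUT «`[Γ : U₁] = [Γ : U₂]`»; [NSW] Thm. (12.2.1), proof:
the fields `K₁, K₂` fixed by `U₁, U₂` are arithmetically equivalent, so `[K₁ : ℚ] = [K₂ : ℚ]`):
`hdeg_hP₁_of_containment` at `V = U₁`, where `β(U₁) = U₂`. [cite: NeukirchSchmidtWingberg2008, Thm (12.2.1)] -/
theorem index_eq_of_containment (hU₁ : IsOpen (U₁ : Set (absoluteGaloisGroup ℚ)))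
    (hU₂ : IsOpen (U₂ : Set (absoluteGaloisGroup ℚ))) (β : U₁ ≃ₜ* U₂)
    (hβ : ∀ A : ValuationSubring (AlgebraicClosure ℚ), A ≠ ⊤ →
      ∃ B : ValuationSubring (AlgebraicClosure ℚ), B ≠ ⊤ ∧
        ((MulAction.stabilizer (absoluteGaloisGroup ℚ) A).subgroupOf U₁).map β.toMulEquiv.toMonoidHom ≤
          (MulAction.stabilizer (absoluteGaloisGroup ℚ) B).subgroupOf U₂)
    (hβ' : ∀ B : ValuationSubring (AlgebraicClosure ℚ), B ≠ ⊤ →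
      ∃ A : ValuationSubring (AlgebraicClosure ℚ), A ≠ ⊤ ∧
        ((MulAction.stabilizer (absoluteGaloisGroup ℚ) B).subgroupOf U₂).map
            β.toMulEquiv.symm.toMonoidHom ≤
          (MulAction.stabilizer (absoluteGaloisGroup ℚ) A).subgroupOf U₁) :
    U₁.index = U₂.index := by
  obtain ⟨hdeg, -⟩ := hdeg_hP₁_of_containment hU₁ hU₂ β hβ hβ' U₁ hU₁ le_rfl
  exact ((finrank_KV_eq_index U₁ hU₁).symm.trans hdeg).trans
    ((finrank_eq_of_intermediateField_eq (congrArg KV (map_map_subtype_self β))).trans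
      (finrank_KV_eq_index U₂ hU₂))

end Corollaries

end NeukirchUchidaProof

end Literature.AnabelianGeometry.AbsoluteAnabelian

end
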